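import Mathlib
import Summits.ABC.ABC.Theorems.ThreeSlotOneSlot

/-!
# The one-slot composite case of `ZooSorting` (stmt-ABC-24024): `1 + b = c`, `c` not a prime power

Birth stub `stub_oneSlot_notPrimePow` of `route-ABC-ThreeSlotCyclotomicDescent`, proved outright
(elementary; no Zsigmondy needed). With `ω(bc) ≤ 3` and `c` not a prime power: `ω(c) = 2` and
`b = s^x` is a prime power; then

* `s = 2`: either `c = p q` is squarefree (`c ≤ rad`) or `c = p^y q^z` with `max(y,z) ≥ 2` — wall W2b;
* `s` odd, so `c = 2^y Q^z`:
  - `x = 1`: `c = s + 1 ≤ 2 s ≤ rad`;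
  - `x = 2u` even: `s^(2u) + 1 ≡ 2 (mod 4)` forces `y = 1`; then `z = 1` (`c ≤ rad`), `z = 2, u = 1`
    (`s ≥ Q`, `c ≤ rad`), `z = 2, u ≥ 2` (wall W4 (ii)), `z ≥ 3` odd (wall W4 (i)), `z ≥ 4` even (solved
    family L2);
  - `x` odd `≥ 3`: `z ≥ 2` is wall W1b; `z = 1` gives `c ≤ rad` because `(s^x+1)/(s+1)` is odd, so
    `2^y ∣ s + 1` and `c = 2^y Q ≤ (s+1) Q ≤ 2 s Q ≤ rad`.

`oneSlot_composite` is the clean five-way statement; `oneSlot_notPrimePow` restates it in the exact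
shape `Goal 1 b c` of the registered skeleton (families inlined as in the route file).
-/

namespace Summit.ABC.ABC.Theorems.ThreeSlotOneSlotComposite

open Literature.NumberTheory.DiophantineGeometry (IsABCTriple rad rad_def)
open UniqueFactorizationMonoid (radical)
open Literature.NumberTheory.DiophantineGeometry.Pasten (coprime_right_of_isABCTriple)
open Summit.ABC.ABC.Theorems.ThreeSlotZooSquareSquare (mul_dvd_radical)
open Summit.ABC.ABC.Theorems.ThreeSlotOneSlot (exists_eq_pow_mul_pow_of_card_primeFactors_eq_two
  oneSlot_card_add_le)

/-- `(s^x + 1)/(s + 1)` is odd for `s, x` odd: `s^(2u+1) + 1 = (s + 1)·M` with `M` odd. [folklore] -/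
theorem exists_odd_cofactor_pow_add_one {s : ℕ} (hs : Odd s) (u : ℕ) :
    ∃ M : ℕ, s ^ (2 * u + 1) + 1 = (s + 1) * M ∧ Odd M := by
  induction u with
  | zero => exact ⟨1, by ring, odd_one⟩
  | succ u ih =>
    obtain ⟨M, hM, hMo⟩ := ih
    have hsM : Odd (s * M) := hs.mul hMo
    obtain ⟨w, hw⟩ : ∃ w, s * M = w + 1 := ⟨s * M - 1, by rcases hsM with ⟨k, hk⟩; omega⟩
    refine ⟨s * w + 1, ?_, ?_⟩
    · have hM' : (s : ℤ) ^ (2 * u + 1) + 1 = (s + 1) * M := by exact_mod_cast hM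
      have hw' : (s : ℤ) * M = w + 1 := by exact_mod_cast hw
      have : (s : ℤ) ^ (2 * (u + 1) + 1) + 1 = (s + 1) * (s * w + 1) := by
        rw [show 2 * (u + 1) + 1 = (2 * u + 1) + 2 by ring, pow_add]
        linear_combination (s : ℤ) ^ 2 * hM' + ((s : ℤ) * (s + 1)) * hw'
      exact_mod_cast this
    · have hwe : Even w := by rcases hsM with ⟨k, hk⟩; exact ⟨k, by omega⟩
      exact (hwe.mul_left s).add_one

/-- **The one-slot composite case**, clean form: for an abc triple `(1, b, c)` with `ω(bc) ≤ 3` and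
`c` not a prime power, either `c ≤ 5·rad`, or `(b, c)` has one of the shapes W2b, W1b, W4, L2 of the
route's family lists. [folklore; elementary] -/
theorem oneSlot_composite : ∀ b c : ℕ, IsABCTriple 1 b c → (1 * b * c).primeFactors.card ≤ 3 →
    ¬ IsPrimePow c →
    c ≤ 5 * rad 1 b c ∨
    (∃ x y z p q : ℕ, p.Prime ∧ q.Prime ∧ p ≠ q ∧ 2 ≤ max y z ∧ b = 2 ^ x ∧ c = p ^ y * q ^ z) ∨
    (∃ x y p r z : ℕ, p.Prime ∧ r.Prime ∧ Odd p ∧ Odd x ∧ 3 ≤ x ∧ 1 ≤ y ∧ 2 ≤ z ∧ b = p ^ x ∧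
      c = 2 ^ y * r ^ z) ∨
    (∃ u p r z : ℕ, p.Prime ∧ r.Prime ∧ 1 ≤ u ∧ b = p ^ (2 * u) ∧ c = 2 * r ^ z ∧
      ((3 ≤ z ∧ Odd z) ∨ (z = 2 ∧ 2 ≤ u))) ∨
    (∃ u p r z : ℕ, p.Prime ∧ r.Prime ∧ 1 ≤ u ∧ 4 ≤ z ∧ Even z ∧ b = p ^ (2 * u) ∧
      c = 2 * r ^ z) := by
  intro b c h hω hnpp
  have hbc' : b.Coprime c := coprime_right_of_isABCTriple h
  obtain ⟨-, hb0, hbc, -⟩ := id h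
  have hc2 : 2 ≤ c := by omega
  have hc0 : 0 < c := by omega
  -- `ω(c) = 2` and `b` is a prime power
  have hcard := oneSlot_card_add_le h hω
  have hc1 : c.primeFactors.card ≠ 1 := fun e =>
    hnpp (isPrimePow_iff_card_primeFactors_eq_one.mpr e)
  have hcpos : 0 < c.primeFactors.card :=
    Finset.card_pos.mpr (Nat.nonempty_primeFactors.mpr hc2)
  have hb2 : 2 ≤ b := by
    by_contra hb1
    have hb1 : b = 1 := by omega
    subst hb1
    have hc2' : c = 2 := by omega
    subst hc2'
    exact hnpp Nat.prime_two.isPrimePow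
  have hbpos : 0 < b.primeFactors.card :=
    Finset.card_pos.mpr (Nat.nonempty_primeFactors.mpr hb2)
  have hcc : c.primeFactors.card = 2 := by omega
  have hbb : b.primeFactors.card = 1 := by omega
  obtain ⟨s, x, hs, hx, rfl⟩ :=
    (isPrimePow_nat_iff _).mp (isPrimePow_iff_card_primeFactors_eq_one.mpr hbb)
  obtain ⟨P, Q, y, z, hP, hQ, hPQ, hy, hz, hc⟩ :=
    exists_eq_pow_mul_pow_of_card_primeFactors_eq_two hcc
  have hx0 : x ≠ 0 := by omega
  have hy0 : y ≠ 0 := by omega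
  have hz0 : z ≠ 0 := by omega
  -- the three primes are distinct, so `rad ≥ s P Q`
  have hPc : P ∣ c := by rw [hc]; exact dvd_mul_of_dvd_left (dvd_pow_self P hy0) _
  have hQc : Q ∣ c := by rw [hc]; exact dvd_mul_of_dvd_right (dvd_pow_self Q hz0) _
  have hsb : s ∣ s ^ x := dvd_pow_self s hx0
  have hsP : s ≠ P := fun e => hs.one_lt.ne' (Nat.eq_one_of_dvd_coprimes hbc' hsb (e ▸ hPc))
  have hsQ : s ≠ Q := fun e => hs.one_lt.ne' (Nat.eq_one_of_dvd_coprimes hbc' hsb (e ▸ hQc))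
  have hs0 : 0 < s := hs.pos
  have hn : 1 * s ^ x * c ≠ 0 := by positivity
  have hrad : s * P * Q ≤ rad 1 (s ^ x) c := by
    rw [rad_def]
    refine Nat.le_of_dvd (Nat.radical_pos _)
      (mul_dvd_radical hs hP hQ hsP hsQ hPQ.ne hn ?_ ?_ ?_)
    · exact dvd_mul_of_dvd_left (dvd_mul_of_dvd_right hsb 1) c
    · exact dvd_mul_of_dvd_right hPc _
    · exact dvd_mul_of_dvd_right hQc _
  have hP2 := hP.two_le
  have hQ2 := hQ.two_le
  have hs2 := hs.two_le
  by_cases hs2' : s = 2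
  · -- `b = 2^x`, `c` odd with two prime factors
    subst hs2'
    by_cases hmax : 2 ≤ max y z
    · exact Or.inr (Or.inl ⟨x, y, z, P, Q, hP, hQ, hPQ.ne, hmax, rfl, hc⟩)
    · left
      have hy1 : y = 1 := by have := le_max_left y z; omega
      have hz1 : z = 1 := by have := le_max_right y z; omega
      subst hy1 hz1
      rw [pow_one, pow_one] at hc
      nlinarith [hrad, hc]
  · -- `s` odd, so `c` is even and `P = 2`
    have hsodd : Odd s := hs.eq_two_or_odd'.resolve_left hs2'
    have hceven : Even c := by rw [← hbc]; exact Odd.add_odd odd_one hsodd.pow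
    have hP2' : P = 2 := by
      have h2c : 2 ∣ c := even_iff_two_dvd.mp hceven
      rw [hc] at h2c
      rcases (Nat.Prime.dvd_mul Nat.prime_two).mp h2c with h2 | h2
      · exact ((Nat.prime_dvd_prime_iff_eq Nat.prime_two hP).mp
          (Nat.prime_two.dvd_of_dvd_pow h2)).symm
      · have := (Nat.prime_dvd_prime_iff_eq Nat.prime_two hQ).mp (Nat.prime_two.dvd_of_dvd_pow h2)
        omega
    subst hP2'
    rcases Nat.lt_or_ge x 2 with hx1 | hx2
    · -- `x = 1`: `c = s + 1 ≤ 2 s ≤ rad`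
      left
      have hx1 : x = 1 := by omega
      subst hx1
      simp only [pow_one] at hbc hrad ⊢
      nlinarith [hrad, hQ2, hs2]
    · rcases Nat.even_or_odd x with ⟨u, hu⟩ | hxodd
      · -- `x = 2u`: `y = 1`
        have hu1 : 1 ≤ u := by omega
        have hxu : x = 2 * u := by omega
        have hy1 : y = 1 := by
          by_contra hy1
          have hy2 : 2 ≤ y := by omega
          have h4 : 4 ∣ c := by
            rw [hc]
            exact Dvd.dvd.mul_right (by rw [show (4 : ℕ) = 2 ^ 2 by norm_num]; exact pow_dvd_pow 2 hy2) _
          obtain ⟨k, hk⟩ : Odd (s ^ u) := hsodd.pow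
          have hcsq : c = (s ^ u) ^ 2 + 1 := by rw [← hbc, hxu, pow_mul']; ring
          rw [hcsq, hk, show (2 * k + 1) ^ 2 + 1 = 4 * (k ^ 2 + k) + 2 by ring] at h4
          omega
        subst hy1
        rw [pow_one] at hc
        rcases Nat.lt_or_ge z 3 with hz3 | hz3
        · interval_cases z
          · -- `z = 1`: `c = 2 Q ≤ rad`
            left
            rw [pow_one] at hc
            nlinarith [hrad, hs2]
          · rcases Nat.lt_or_ge u 2 with hu2 | hu2
            · -- `u = 1`: `s² + 1 = 2 Q²`, so `Q ≤ s` and `c = 2 Q² ≤ 2 s Q ≤ rad`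
              left
              have hu1' : u = 1 := by omega
              subst hu1'
              have hx2' : x = 2 := by omega
              subst hx2'
              have hQs : Q ≤ s := by nlinarith [hbc, hc]
              have : c ≤ s * 2 * Q := by rw [hc]; nlinarith [hQs, hQ2]
              linarith [hrad]
            · -- `u ≥ 2`: wall W4 (ii)
              exact Or.inr (Or.inr (Or.inr (Or.inl
                ⟨u, s, Q, 2, hs, hQ, hu1, by rw [hxu], hc, Or.inr ⟨rfl, hu2⟩⟩)))
        · rcases Nat.even_or_odd z with hze | hzo
          · -- `z ≥ 4` even: solved family L2
            have hz4 : 4 ≤ z := by rcases hze with ⟨k, hk⟩; omega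
            exact Or.inr (Or.inr (Or.inr (Or.inr ⟨u, s, Q, z, hs, hQ, hu1, hz4, hze, by rw [hxu], hc⟩)))
          · -- `z ≥ 3` odd: wall W4 (i)
            exact Or.inr (Or.inr (Or.inr (Or.inl
              ⟨u, s, Q, z, hs, hQ, hu1, by rw [hxu], hc, Or.inl ⟨hz3, hzo⟩⟩)))
      · -- `x` odd, `x ≥ 3`
        have hx3 : 3 ≤ x := by rcases hxodd with ⟨k, hk⟩; omega
        rcases Nat.lt_or_ge z 2 with hz1 | hz2
        · -- `z = 1`: `(s^x+1)/(s+1)` odd ⇒ `2^y ∣ s + 1` ⇒ `c ≤ (s+1) Q ≤ 2 s Q ≤ rad`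
          left
          have hz1 : z = 1 := by omega
          subst hz1
          rw [pow_one] at hc
          obtain ⟨u, hu⟩ := hxodd
          obtain ⟨M, hM, hMo⟩ := exists_odd_cofactor_pow_add_one hsodd u
          have hkey : 2 ^ y * Q = (s + 1) * M := by rw [← hM, ← hu]; omega
          have hcopM : Nat.Coprime (2 ^ y) M :=
            Nat.Coprime.pow_left _ (Nat.coprime_two_right.mpr hMo).symm
          have hdvd : 2 ^ y ∣ s + 1 := hcopM.dvd_of_dvd_mul_right (by rw [← hkey]; exact Dvd.intro Q rfl)
          have hle : 2 ^ y ≤ s + 1 := Nat.le_of_dvd (by omega) hdvd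
          have : c ≤ (s + 1) * Q := by rw [hc]; exact Nat.mul_le_mul_right Q hle
          nlinarith [hrad, hs2, hQ2]
        · -- `z ≥ 2`: wall W1b
          exact Or.inr (Or.inr (Or.inl ⟨x, y, s, Q, z, hs, hQ, hsodd, hxodd, hx3, hy, hz2, rfl, hc⟩))

/-- **Birth stub `stub_oneSlot_notPrimePow` of `ZooSorting`** in the exact shape `Goal 1 b c` of the
registered skeleton (families L1–L4, W1–W4 inlined as in the route file, both orientations): for an abc
triple `(1, b, c)` with `ω(bc) ≤ 3` and `c` not a prime power, `c ≤ 5·rad` or `(1, b, c)` lies in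
W2b, W1b, W4 or L2. -/
theorem oneSlot_notPrimePow : ∀ b c : ℕ, Literature.NumberTheory.DiophantineGeometry.IsABCTriple 1 b c → (1 * b * c).primeFactors.card ≤ 3 → ¬ IsPrimePow c →
    c ≤ 5 * Literature.NumberTheory.DiophantineGeometry.rad 1 b c ∨ (((∃ u v q r z : ℕ, q.Prime ∧ r.Prime ∧ 1 ≤ u ∧ 1 ≤ v ∧ 3 ≤ z ∧ 1 = 2 ^ (2 * u) ∧ b = q ^ (2 * v) ∧ c = r ^ z) ∨ (∃ u p r z : ℕ, p.Prime ∧ r.Prime ∧ 1 ≤ u ∧ 4 ≤ z ∧ Even z ∧ 1 = 1 ∧ b = p ^ (2 * u) ∧ c = 2 * r ^ z) ∨ (∃ x q r z : ℕ, q.Prime ∧ r.Prime ∧ Odd r ∧ Odd z ∧ 3 ≤ z ∧ 1 = 1 ∧ b = 2 ^ x * q ^ 2 ∧ c = r ^ z) ∨ (∃ A l q y : ℕ, q.Prime ∧ 5 ≤ l ∧ 2 ≤ y ∧ (2 ∣ y ∨ 3 ∣ y) ∧ 1 = A ^ l ∧ b = q ^ y ∧ c = (A + 1) ^ l)) ∨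 ((∃ u v q r z : ℕ, q.Prime ∧ r.Prime ∧ 1 ≤ u ∧ 1 ≤ v ∧ 3 ≤ z ∧ b = 2 ^ (2 * u) ∧ 1 = q ^ (2 * v) ∧ c = r ^ z) ∨ (∃ u p r z : ℕ, p.Prime ∧ r.Prime ∧ 1 ≤ u ∧ 4 ≤ z ∧ Even z ∧ b = 1 ∧ 1 = p ^ (2 * u) ∧ c = 2 * r ^ z) ∨ (∃ x q r z : ℕ, q.Prime ∧ r.Prime ∧ Odd r ∧ Odd z ∧ 3 ≤ z ∧ b = 1 ∧ 1 = 2 ^ x * q ^ 2 ∧ c = r ^ z) ∨ (∃ A l q y : ℕ, q.Prime ∧ 5 ≤ l ∧ 2 ≤ y ∧ (2 ∣ y ∨ 3 ∣ y) ∧ b = A ^ l ∧ 1 = q ^ y ∧ c = (A + 1) ^ l))) ∨ (((∃ x y q r z : ℕ, q.Prime ∧ r.Prime ∧ Odd r ∧ Odd z ∧ 3 ≤ z ∧ 3 ≤ y ∧ 1 = 1 ∧ b = 2 ^ x * q ^ y ∧ c = r ^ z) ∨ (∃ x y p r z : ℕ, p.Prime ∧ r.Prime ∧ Odd p ∧ Odd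 x ∧ 3 ≤ x ∧ 1 ≤ y ∧ 2 ≤ z ∧ 1 = 1 ∧ b = p ^ x ∧ c = 2 ^ y * r ^ z) ∨ (∃ x y z p q : ℕ, p.Prime ∧ q.Prime ∧ p ≠ q ∧ 1 ≤ x ∧ 1 ≤ y ∧ Odd z ∧ 3 ≤ z ∧ 1 = 1 ∧ b = p ^ x * q ^ y ∧ c = 2 ^ z) ∨ (∃ x y z p q : ℕ, p.Prime ∧ q.Prime ∧ p ≠ q ∧ 2 ≤ max y z ∧ 1 = 1 ∧ b = 2 ^ x ∧ c = p ^ y * q ^ z) ∨ (∃ A l q y : ℕ, q.Prime ∧ 3 ≤ l ∧ 2 ≤ y ∧ ¬ 3 ∣ y ∧ (l = 3 ∨ ¬ 2 ∣ y) ∧ 1 = A ^ l ∧ b = q ^ y ∧ c = (A + 1) ^ l) ∨ (∃ u p r z : ℕ, p.Prime ∧ r.Prime ∧ 1 ≤ u ∧ 1 = 1 ∧ b = p ^ (2 * u) ∧ c = 2 * r ^ z ∧ ((3 ≤ z ∧ Odd z) ∨ (z = 2 ∧ 2 ≤ u)))) ∨ ((∃ x y q r z : ℕ, q.Prime ∧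 r.Prime ∧ Odd r ∧ Odd z ∧ 3 ≤ z ∧ 3 ≤ y ∧ b = 1 ∧ 1 = 2 ^ x * q ^ y ∧ c = r ^ z) ∨ (∃ x y p r z : ℕ, p.Prime ∧ r.Prime ∧ Odd p ∧ Odd x ∧ 3 ≤ x ∧ 1 ≤ y ∧ 2 ≤ z ∧ b = 1 ∧ 1 = p ^ x ∧ c = 2 ^ y * r ^ z) ∨ (∃ x y z p q : ℕ, p.Prime ∧ q.Prime ∧ p ≠ q ∧ 1 ≤ x ∧ 1 ≤ y ∧ Odd z ∧ 3 ≤ z ∧ b = 1 ∧ 1 = p ^ x * q ^ y ∧ c = 2 ^ z) ∨ (∃ x y z p q : ℕ, p.Prime ∧ q.Prime ∧ p ≠ q ∧ 2 ≤ max y z ∧ b = 1 ∧ 1 = 2 ^ x ∧ c = p ^ y * q ^ z) ∨ (∃ A l q y : ℕ, q.Prime ∧ 3 ≤ l ∧ 2 ≤ y ∧ ¬ 3 ∣ y ∧ (l = 3 ∨ ¬ 2 ∣ y) ∧ b = A ^ l ∧ 1 = q ^ y ∧ c = (A + 1) ^ l) ∨ (∃ u p r z : ℕ, p.Prime ∧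 r.Prime ∧ 1 ≤ u ∧ b = 1 ∧ 1 = p ^ (2 * u) ∧ c = 2 * r ^ z ∧ ((3 ≤ z ∧ Odd z) ∨ (z = 2 ∧ 2 ≤ u))))) := by
  intro b c h hω hn
  rcases oneSlot_composite b c h hω hn with h1 | ⟨x, y, z, p, q, hp, hq, hpq, hm, hb, hc⟩ |
      ⟨x, y, p, r, z, hp, hr, hpo, hxo, hx, hy, hz, hb, hc⟩ | ⟨u, p, r, z, hp, hr, hu, hb, hc, hz⟩ |
      ⟨u, p, r, z, hp, hr, hu, hz, hze, hb, hc⟩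
  · exact Or.inl h1
  · exact Or.inr (Or.inr (Or.inl (Or.inr (Or.inr (Or.inr (Or.inl
      ⟨x, y, z, p, q, hp, hq, hpq, hm, rfl, hb, hc⟩))))))
  · exact Or.inr (Or.inr (Or.inl (Or.inr (Or.inl
      ⟨x, y, p, r, z, hp, hr, hpo, hxo, hx, hy, hz, rfl, hb, hc⟩))))
  · exact Or.inr (Or.inr (Or.inl (Or.inr (Or.inr (Or.inr (Or.inr (Or.inr
      ⟨u, p, r, z, hp, hr, hu, rfl, hb, hc, hz⟩)))))))
  · exact Or.inr (Or.inl (Or.inl (Or.inr (Or.inl ⟨u, p, r, z, hp, hr, hu, hz, hze, rfl, hb, hc⟩))))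

end Summit.ABC.ABC.Theorems.ThreeSlotOneSlotComposite
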